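import Literature.Probability.LatticeModels.XYTorusFreeBoxComparison
import HarnessLib

/-!
# Plane rotators (classical XY model) with general pair couplings on a finite vertex set:
# Griffiths–Ginibre comparison of two-point functions under enlarging the system and raising
# ferromagnetic couplings; the layered model dominates the single layer

Topic `Literature/Probability/LatticeModels`. J. Ginibre, *General formulation of Griffiths' inequalities*,
Comm. Math. Phys. 16 (1970) 310–328 (Prop. 3 with Example 4, the plane-rotator example `cos(m·φ)`): for plane
rotators with ferromagnetic pair couplings `−H = ∑ J_{xy} cos(θ_x − θ_y)`, `J ≥ 0`, every correlation `⟨cos(m·θ)⟩` is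
non-decreasing in every coupling; the standard corollaries (Griffiths 1967 for Ising, verbatim for rotators) are that
correlations increase with the couplings AND with the size of the system. The tree proves the monotone form for
characters of a compact abelian group (`ginibreExpect_reChar_mono`, `GinibreInequality.lean`) and uses it for the XY
torus-versus-free-box comparison (`XYTorusFreeBoxComparison.lean`, uniform coupling). This file states the
**general-pair-coupling** version in the tree's XY vocabulary (`torusHaar`, `diffChar`, `cosDiff` of
`DisorderedXYModel.lean` / `MMPInequality.lean`): couplings `J : V × V → ℝ` on ORDERED pairs, weight
`exp(∑_{(x,y)} J(x,y) cos(θ_y − θ_x))`, two-point function `twoPoint J a b = ⟨cos(θ_a − θ_b)⟩_{V,J}` — the form in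
which an anisotropic / LAYERED model (in-plane couplings `J∥`, interlayer couplings `J⊥`) is written — and proves
the two consequences the layered-superconductor modelling of the `hubbard-tc` cell cites (ASSUMPTIONS.md §1 key K4;
VERDICTS.md §3 «ferromagnetic interlayer coupling RAISES the ordering tendency»):

* `PlaneRotator.twoPoint_mono` — **monotonicity**: `0 ≤ J ≤ J'` pointwise ⇒ `⟨cos(θ_a−θ_b)⟩_J ≤ ⟨cos(θ_a−θ_b)⟩_{J'}`;
  hence in-plane correlations of a layered model are non-decreasing in the interlayer couplings `J⊥ ≥ 0`
  (`twoPoint_layer_mono_interlayer`).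
* `PlaneRotator.twoPoint_extend_eq` — **restriction**: a model on `V` whose couplings are the zero extension
  (`extendCoupling`) of couplings `J₀` on `S` along an injection `τ : S ↪ V` has, between image points, the two-point
  functions of the model on `S` (the free rotators integrate out: marginal of the torus Haar measure along `τ`,
  `pi_map_comp_injective`).
* `PlaneRotator.twoPoint_le_of_embedding` — **comparison under embedding**: `τ : S → V` injective, `J₀ ≥ 0` on `S`,
  `J ≥ 0` on `V`, `J(τx, τy) ≥ J₀(x, y)` ⇒ `⟨cos(θ_a−θ_b)⟩_{S,J₀} ≤ ⟨cos(θ_{τa}−θ_{τb})⟩_{V,J}`. The layered instance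
  `twoPoint_layer_le_layered`: for a stack `V₀ × K` of copies of a layer `V₀` with in-plane couplings `≥ J₀ ≥ 0` in
  layer `k` and ANY non-negative couplings elsewhere (other layers, interlayer bonds of any range), the in-plane
  two-point function in layer `k` dominates the single-layer (strictly two-dimensional) one.

Reading for the cell (finite volume, every vertex set, inverse temperature absorbed in `J`): a strictly two-dimensional
layer is a LOWER bound for the layered system's in-plane order, so an upper bound on a two-dimensional ordering
temperature bounds a three-dimensional one ONLY through a separately stated transfer assumption (key K4) — never by
monotonicity.

Not here: infinite volume / transition temperatures (no `T_c` is defined for rotators in the tree); the comparison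
plane rotor ≤ Ising (Aizenman–Simon 1980) and mean-field upper bounds on `T_c` (Ising side: tree
`Literature.Barriers.CriticalPhenomena.LongRangeIsing.one_le_mul_of_magnetization_pos`); quantum models (no Griffiths
inequalities are available for the Hubbard model; the quantum XY case is `QuantumLattice/XYGriffithsBLU*.lean`).

References: J. Ginibre, Comm. Math. Phys. 16 (1970) 310 [Ginibre1970]; R. B. Griffiths, J. Math. Phys. 8 (1967) 478,
484 (the Ising prototype) [Griffiths1967]; cell documents pub/hubbard-tc/ASSUMPTIONS.md §1, VERDICTS.md §3.
-/

noncomputable section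

open MeasureTheory Filter Finset
open scoped Topology BigOperators

namespace Literature.Probability.LatticeModels

namespace PlaneRotator

/-! ### Pair couplings on ordered pairs; extension of couplings by zero -/

section Algebra

variable {V S : Type*}

variable (V) in
/-- The family of relative-angle characters `θ ↦ θ̄_x θ_y` indexed by ORDERED pairs `(x, y) ∈ V × V` — the interaction
"cosines" `Re(θ̄_x θ_y) = cos(θ_y − θ_x)` of the plane-rotator model `−H = ∑_{(x,y)} J(x,y) cos(θ_x − θ_y)` with general
pair couplings (Ginibre's Example 4 with `m = e_y − e_x`). [cite: Ginibre1970, Example 4 (plane rotators, cos(m·φ))] -/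
def pairChars (p : V × V) : (V → Circle) →ₜ* Circle :=
  diffChar p.1 p.2

/-- `pairChars V p = diffChar p.1 p.2`. [cite: Ginibre1970, Example 4 (plane rotators, cos(m·φ))] -/
@[simp] theorem pairChars_apply (p : V × V) : pairChars V p = diffChar p.1 p.2 := rfl

/-- **Extension of couplings by zero** along `τ : S → V`: `J(τx, τy) = J₀(x, y)` and `J = 0` off the image of
`τ × τ` (for injective `τ`; Mathlib's `Function.extend`). [folklore] -/
def extendCoupling (τ : S → V) (J₀ : S × S → ℝ) : V × V → ℝ :=
  Function.extend (Prod.map τ τ) J₀ 0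

/-- On image pairs the extended coupling is `J₀` (injective `τ`). [folklore] -/
private theorem extendCoupling_apply {τ : S → V} (hτ : Function.Injective τ) (J₀ : S × S → ℝ) (q : S × S) :
    extendCoupling τ J₀ (Prod.map τ τ q) = J₀ q :=
  (hτ.prodMap hτ).extend_apply _ _ _

/-- Off the image the extended coupling vanishes. [folklore] -/
private theorem extendCoupling_of_not_mem_range {τ : S → V} (J₀ : S × S → ℝ) {p : V × V}
    (hp : p ∉ Set.range (Prod.map τ τ)) : extendCoupling τ J₀ p = 0 := by
  rw [extendCoupling, Function.extend_apply' _ _ _ (fun ⟨q, hq⟩ => hp ⟨q, hq⟩), Pi.zero_apply]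

/-- The extended coupling is non-negative when `J₀` is. [folklore] -/
private theorem extendCoupling_nonneg {τ : S → V} {J₀ : S × S → ℝ} (hJ₀ : ∀ q, 0 ≤ J₀ q) (p : V × V) :
    0 ≤ extendCoupling τ J₀ p := by
  classical
  rw [extendCoupling, Function.extend_def]
  split_ifs with h
  · exact hJ₀ _
  · exact le_rfl

end Algebra

/-! ### The extended Hamiltonian is the small Hamiltonian of the restricted configuration -/

section Sums

variable {V S : Type*} [Fintype V] [Fintype S]

/-- The Hamiltonian of the extended couplings is the `S`-Hamiltonian of the restricted configuration `θ ∘ τ`.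
[folklore] -/
private theorem ginibreHamiltonian_extendCoupling {τ : S → V} (hτ : Function.Injective τ) (J₀ : S × S → ℝ)
    (θ : V → Circle) :
    ginibreHamiltonian (pairChars V) (extendCoupling τ J₀) θ =
      ginibreHamiltonian (pairChars S) J₀ (fun s => θ (τ s)) := by
  classical
  unfold ginibreHamiltonian
  have hinj : Function.Injective (Prod.map τ τ) := hτ.prodMap hτ
  -- the sum over `V × V` is supported on the image of `τ × τ`
  rw [← Finset.sum_subset (Finset.subset_univ (Finset.univ.image (Prod.map τ τ)))
    (fun p _ hp => by
      rw [extendCoupling_of_not_mem_range J₀ (fun ⟨q, hq⟩ => hp (Finset.mem_image.2 ⟨q, Finset.mem_univ _, hq⟩)),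
        zero_mul]),
    Finset.sum_image fun q _ q' _ h => hinj h]
  refine Finset.sum_congr rfl fun q _ => ?_
  rw [extendCoupling_apply hτ]
  rfl

/-- The Gibbs weight of the extended couplings is the `S`-weight of the restricted configuration. [folklore] -/
private theorem ginibreWeight_extendCoupling {τ : S → V} (hτ : Function.Injective τ) (J₀ : S × S → ℝ)
    (θ : V → Circle) :
    ginibreWeight (pairChars V) (extendCoupling τ J₀) θ = ginibreWeight (pairChars S) J₀ (fun s => θ (τ s)) := by
  rw [ginibreWeight, ginibreWeight, ginibreHamiltonian_extendCoupling hτ]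

end Sums

/-! ### Two-point functions; monotonicity in the couplings (Ginibre) -/

section TwoPoint

variable {V : Type*} [Fintype V] [MeasurableSpace Circle] [BorelSpace Circle]

/-- The **XY two-point function with general pair couplings** `⟨cos(θ_a − θ_b)⟩_{V,J}`: the Ginibre–Gibbs
expectation of `cosDiff a b = Re(θ̄_a θ_b)` on the torus `U(1)^V` (Haar probability `torusHaar V`) for the weights
`exp(∑_{(x,y) ∈ V×V} J(x,y) Re(θ̄_x θ_y))`, couplings on ORDERED pairs, inverse temperature absorbed in `J` (as in
`DisorderedXYModel.lean`, the Borel structure of `Circle` is an instance ARGUMENT). [cite: Ginibre1970, Example 4 (plane rotators, cos(m·φ))] -/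
def twoPoint (J : V × V → ℝ) (a b : V) : ℝ :=
  ginibreExpect (torusHaar V) (pairChars V) J (cosDiff a b)

/-- The two-point function is a Ginibre expectation of the real part of a character (`cosDiff = Re ∘ diffChar`).
[cite: Ginibre1970, Example 4 (plane rotators, cos(m·φ))] -/
theorem twoPoint_eq_ginibreExpect_reChar (J : V × V → ℝ) (a b : V) :
    twoPoint J a b = ginibreExpect (torusHaar V) (pairChars V) J (reChar (diffChar a b)) := by
  rw [twoPoint, show (cosDiff a b : (V → Circle) → ℝ) = reChar (diffChar a b) from
    funext fun θ => cosDiff_eq_reChar a b θ]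

/-- **Ginibre monotonicity for XY two-point functions with general pair couplings.** `0 ≤ J ≤ J'` (pointwise on
ordered pairs) ⇒ `⟨cos(θ_a − θ_b)⟩_{V,J} ≤ ⟨cos(θ_a − θ_b)⟩_{V,J'}` for all `a, b ∈ V`.
[cite: Ginibre1970, Prop. 3 with Example 4 (plane rotators)] -/
theorem twoPoint_mono {J J' : V × V → ℝ} (hJ : ∀ p, 0 ≤ J p) (hJJ' : ∀ p, J p ≤ J' p) (a b : V) :
    twoPoint J a b ≤ twoPoint J' a b := by
  rw [twoPoint_eq_ginibreExpect_reChar, twoPoint_eq_ginibreExpect_reChar]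
  exact ginibreExpect_reChar_mono _ surjective_mul_self_torus _ _ hJ hJJ'

end TwoPoint

/-! ### Restriction: couplings supported on the image of an injection; comparison under embedding -/

section Restrict

variable {V S : Type*} [Fintype V] [Fintype S] [MeasurableSpace Circle] [BorelSpace Circle]

/-- Transfer of integrals along the restriction `θ ↦ θ ∘ τ` (marginal of the torus Haar measure along an injection,
`pi_map_comp_injective`). [folklore] -/
private theorem integral_comp_restrict {τ : S → V} (hτ : Function.Injective τ)
    {F : (S → Circle) → ℝ} (hF : Measurable F) :
    ∫ θ, F (fun s => θ (τ s)) ∂(torusHaar V) = ∫ φ, F φ ∂(torusHaar S) := by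
  have hmeas : Measurable fun (θ : V → Circle) (s : S) => θ (τ s) :=
    measurable_pi_lambda _ fun s => measurable_pi_apply _
  rw [torusHaar, torusHaar, ← pi_map_comp_injective _ hτ, integral_map hmeas.aemeasurable hF.aestronglyMeasurable]

/-- **Restriction.** For injective `τ : S → V`, the two-point function of the model on `V` with the couplings
`J₀` extended by zero, between image points, equals the two-point function of the model on `S`:
`⟨cos(θ_{τa} − θ_{τb})⟩_{V, ext J₀} = ⟨cos(θ_a − θ_b)⟩_{S, J₀}` (the remaining rotators are free and integrate out: the
zero-coupling reduction step of the Griffiths–Ginibre «correlations increase with the size of the system» argument,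
plane-rotator example). [cite: Ginibre1970, Example 4 with Prop. 3 (plane rotators; subsystem at zero coupling)] -/
theorem twoPoint_extend_eq {τ : S → V} (hτ : Function.Injective τ) (J₀ : S × S → ℝ) (a b : S) :
    twoPoint (extendCoupling τ J₀) (τ a) (τ b) = twoPoint J₀ a b := by
  unfold twoPoint ginibreExpect
  have hw : ∀ θ : V → Circle, ginibreWeight (pairChars V) (extendCoupling τ J₀) θ =
      ginibreWeight (pairChars S) J₀ (fun s => θ (τ s)) := ginibreWeight_extendCoupling hτ J₀
  have hf : ∀ θ : V → Circle, cosDiff (τ a) (τ b) θ = cosDiff a b (fun s => θ (τ s)) := fun θ => rfl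
  simp_rw [hw, hf]
  have hFc : Continuous fun φ : S → Circle => cosDiff a b φ * ginibreWeight (pairChars S) J₀ φ :=
    (continuous_cosDiff a b).mul (continuous_ginibreWeight _ _)
  rw [integral_comp_restrict hτ hFc.measurable, integral_comp_restrict hτ (continuous_ginibreWeight _ _).measurable]

/-- **Griffiths–Ginibre comparison under embedding.** Let `τ : S → V` be injective, `J₀ ≥ 0` couplings on `S` and
`J ≥ 0` couplings on `V` dominating them on the image, `J₀(x, y) ≤ J(τx, τy)`. Then for all `a, b ∈ S`,
`⟨cos(θ_a − θ_b)⟩_{S,J₀} ≤ ⟨cos(θ_{τa} − θ_{τb})⟩_{V,J}`: the two-point function of the small system is a LOWER bound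
for the corresponding one in any ferromagnetic enlargement (restriction identity at the zero extension, then
monotonicity `ext J₀ ≤ J`). [cite: Ginibre1970, Prop. 3 with Example 4 (plane rotators)] -/
theorem twoPoint_le_of_embedding {τ : S → V} (hτ : Function.Injective τ) {J₀ : S × S → ℝ} {J : V × V → ℝ}
    (hJ₀ : ∀ q, 0 ≤ J₀ q) (hJ : ∀ p, 0 ≤ J p) (hdom : ∀ x y, J₀ (x, y) ≤ J (τ x, τ y)) (a b : S) :
    twoPoint J₀ a b ≤ twoPoint J (τ a) (τ b) := by
  rw [← twoPoint_extend_eq hτ J₀ a b]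
  refine twoPoint_mono (extendCoupling_nonneg hJ₀) (fun p => ?_) (τ a) (τ b)
  by_cases hp : p ∈ Set.range (Prod.map τ τ)
  · obtain ⟨⟨x, y⟩, rfl⟩ := hp
    rw [extendCoupling_apply hτ]
    exact hdom x y
  · rw [extendCoupling_of_not_mem_range J₀ hp]
    exact hJ p

end Restrict

/-! ### The layered model -/

section Layered

variable {V₀ K : Type*}

/-- The layer embedding `v ↦ (v, k)` is injective. [folklore] -/
private theorem layerEmbedding_injective (k : K) : Function.Injective fun v : V₀ => (v, k) :=
  fun _ _ h => (Prod.mk.inj h).1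

variable [Fintype V₀] [Fintype K] [MeasurableSpace Circle] [BorelSpace Circle]

/-- **The layered model dominates the single layer.** Let `V₀` be a layer (any finite vertex set with couplings
`J₀ ≥ 0`) and `V₀ × K` a stack of copies of it with ANY non-negative couplings `J` (in-plane couplings in every layer,
interlayer couplings `J⊥ ≥ 0` of any range) whose in-plane part in layer `k` dominates `J₀`:
`J₀(x, y) ≤ J((x,k), (y,k))`. Then every in-plane two-point function in layer `k` dominates the strictly
two-dimensional one: `⟨cos(θ_a − θ_b)⟩_{V₀,J₀} ≤ ⟨cos(θ_{(a,k)} − θ_{(b,k)})⟩_{V₀×K,J}`. Ferromagnetic interlayer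
coupling (and the presence of the other layers) can only RAISE in-plane correlations. [cite: Ginibre1970, Prop. 3 with Example 4 (plane rotators)] -/
theorem twoPoint_layer_le_layered {J₀ : V₀ × V₀ → ℝ} {J : (V₀ × K) × (V₀ × K) → ℝ} (hJ₀ : ∀ q, 0 ≤ J₀ q)
    (hJ : ∀ p, 0 ≤ J p) (k : K) (hdom : ∀ x y, J₀ (x, y) ≤ J ((x, k), (y, k))) (a b : V₀) :
    twoPoint J₀ a b ≤ twoPoint J (a, k) (b, k) :=
  twoPoint_le_of_embedding (layerEmbedding_injective k) hJ₀ hJ hdom a b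

/-- **In-plane correlations are non-decreasing in the interlayer couplings.** For the stack `V₀ × K` with couplings
split as `J = J∥ + J⊥` into a part `J∥ ≥ 0` and an interlayer part, if `0 ≤ J⊥ ≤ J⊥'` pointwise then every two-point
function (in particular every in-plane one) satisfies `⟨cos(θ_p − θ_q)⟩_{J∥+J⊥} ≤ ⟨cos(θ_p − θ_q)⟩_{J∥+J⊥'}`.
[cite: Ginibre1970, Prop. 3 with Example 4 (plane rotators)] -/
theorem twoPoint_layer_mono_interlayer {Jpar Jperp Jperp' : (V₀ × K) × (V₀ × K) → ℝ} (hpar : ∀ p, 0 ≤ Jpar p)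
    (hperp : ∀ p, 0 ≤ Jperp p) (hle : ∀ p, Jperp p ≤ Jperp' p) (p q : V₀ × K) :
    twoPoint (Jpar + Jperp) p q ≤ twoPoint (Jpar + Jperp') p q :=
  twoPoint_mono (fun r => add_nonneg (hpar r) (hperp r)) (fun r => by
    simp only [Pi.add_apply]; linarith [hle r]) p q

end Layered

end PlaneRotator

end Literature.Probability.LatticeModels

end
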